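import Mathlib
import HarnessLib
import Summits.Ventures.LatticeQCDFlow.Scaling.KernelMarginalSMTP2

/-!
# LatticeQCDFlow / Scaling — STRICT MTP₂ marginals II: strict two-point links COMPOSE through an
# integrated coordinate and propagate along integrated chains

HONEST FRAMING: exact (Metropolis-corrected) sampling algorithms for lattice gauge theory;
figures of merit are autocorrelation/cost numbers at stated couplings and volumes; no
continuum-physics claim.

Venture `LatticeQCDFlow` (cell pub-lqcd), topic `Scaling`, FANOUT row 30 (lean-1, GEN-17) — OUR WORK,
sequel of `Scaling/KernelMarginalSMTP2` (strict four-point step, strict integration, strict pure squares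
surviving unrelated integrations).  Here the two facts that make strictness travel THROUGH the block (the
language — pure `(a, j)`-squares, strict pure squares — is that file's):

* §1 **`crossed_lt_of_pureSq_lt`** — for `w > 0` MTP₂ with strict pure `(i, k)`-squares, EVERY pair
  `x, y` crossed at `(i, k)` (`x i < y i`, `y k < x k`, the other coordinates arbitrary) satisfies
  `w x·w y < w (x⊔y)·w (x⊓y)` (three lattice squares multiplied: two from MTP₂, the pure one strict).
* §2 **`pureSq_coordAvg_singleton_link`** — STRICT LINKS COMPOSE: `w > 0` bounded measurable MTP₂ with
  strict pure `(a, k)`- and `(k, j)`-squares (`a, j, k` distinct), reference probability measure not a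
  point mass (`(μ⊗μ){s < t} > 0`) ⇒ `A_k w` has strict pure `(a, j)`-squares (the two crossed terms of
  the symmetrised integrand are strict by §1, the set `{s < t}` has positive measure).
* §3 **`pureSq_coordAvg`** (strict squares survive integrating any block avoiding the pair) and
  **`pureSq_coordAvg_of_chain`** — STRICT LINKING PROPAGATES ALONG AN INTEGRATED CHAIN: `w > 0` bounded
  measurable MTP₂; `a ≠ j` outside the block `s`; a duplicate-free list `[c₁, …, cₙ] ⊆ s` with
  `a, c₁, …, cₙ, j` consecutively strictly linked ⇒ `A_s w` has strict pure `(a, j)`-squares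
  (integrate `c₁` first — it links `a` to `c₂` strictly (§2) while the other links survive
  (`pureSq_coordAvg_singleton`) — and induct on the list; `ne_of_pureSq`: linked sites are distinct).

Sequel `Scaling/AutoregressiveBlockFaithful`: ferromagnetic pair interactions on any graph (C5 in every
dimension).  NOT CLAIMED here: anything model-specific; any number of ours.  Elementary over the parent;
nothing is cited as a fact; no `def`; no `sorry`.
-/

noncomputable section

namespace Summit.Ventures.LatticeQCDFlow.Theory2.Autoregressive

open MeasureTheory Function Set
open Summit.Ventures.LatticeQCDFlow.Exactness

variable {κ : Type*} {X : Type*} [LinearOrder X] [MeasurableSpace X]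

/-! ## §1 Strictly crossed pairs from strict pure squares -/

section Algebra

variable [DecidableEq κ]

omit [MeasurableSpace X] in
/-- **A STRICT PURE SQUARE MAKES EVERY CROSSED PAIR STRICT**: `w > 0` MTP₂ and strictly TP₂ in the
pair `(i, k)` with all other coordinates frozen (`w(z[i↦α][k↦β'])·w(z[i↦α'][k↦β]) <
w(z[i↦α'][k↦β'])·w(z[i↦α][k↦β])` for `α < α'`, `β < β'`) ⇒ `w x·w y < w (x⊔y)·w (x⊓y)` for every
pair `x, y` with `x i < y i` and `y k < x k`, whatever the other coordinates do (three lattice squares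
multiplied: two from MTP₂, the pure one strict). [ours] -/
theorem crossed_lt_of_pureSq_lt {w : (κ → X) → ℝ} (hw0 : ∀ x, 0 < w x)
    (hw : ∀ x y, w x * w y ≤ w (x ⊔ y) * w (x ⊓ y)) {i k : κ} (hik : i ≠ k)
    (hsq : ∀ z (α α' β β' : X), α < α' → β < β' →
      w (update (update z i α) k β') * w (update (update z i α') k β) <
        w (update (update z i α') k β') * w (update (update z i α) k β))
    {x y : κ → X} (hi : x i < y i) (hk : y k < x k) :
    w x * w y < w (x ⊔ y) * w (x ⊓ y) := by
  -- the auxiliary points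
  set u : κ → X := x ⊓ y with hu
  set v : κ → X := x ⊔ y with hv
  set p : κ → X := update x i (y i) with hp
  set q : κ → X := update u i (y i) with hq
  set p' : κ → X := update q k (x k) with hp'
  set m : κ → X := update u k (x k) with hm
  have hui : u i = x i := by simp [hu, inf_eq_left.2 hi.le]
  have huk : u k = y k := by simp [hu, inf_eq_right.2 hk.le]
  -- square 1: the pair `(p, y)` has join `v` and meet `q`
  have h1j : p ⊔ y = v := by
    funext l
    by_cases hli : l = i
    · subst hli; simp [hp, hv, sup_eq_right.2 hi.le]
    · simp [hp, hv, update_of_ne hli]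
  have h1m : p ⊓ y = q := by
    funext l
    by_cases hli : l = i
    · subst hli; simp [hp, hq]
    · simp [hp, hq, hu, update_of_ne hli]
  have S1 : w p * w y ≤ w v * w q := by rw [← h1j, ← h1m]; exact hw p y
  -- square 2: the pair `(x, p')` has join `p` and meet `m`
  have h2j : x ⊔ p' = p := by
    funext l
    by_cases hli : l = i
    · subst hli
      simp [hp', hq, hp, update_of_ne hik, sup_eq_right.2 hi.le]
    · by_cases hlk : l = k
      · subst hlk; simp [hp', hp, update_of_ne hli]
      · simp [hp', hq, hp, hu, update_of_ne hli, update_of_ne hlk]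
  have h2m : x ⊓ p' = m := by
    funext l
    by_cases hli : l = i
    · subst hli
      simp [hp', hq, hm, update_of_ne hik, inf_eq_left.2 hi.le, hui]
    · by_cases hlk : l = k
      · subst hlk; simp [hp', hm]
      · simp [hp', hq, hm, hu, update_of_ne hli, update_of_ne hlk]
  have S2 : w x * w p' ≤ w p * w m := by rw [← h2j, ← h2m]; exact hw x p'
  -- square 3: the pure `(i, k)` square at base `u` is strict
  have S3 : w m * w q < w p' * w u := by
    have h := hsq u (x i) (y i) (y k) (x k) hi hk
    have e1 : update (update u i (x i)) k (x k) = m := by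
      rw [← hui, update_eq_self]
    have e2 : update (update u i (y i)) k (y k) = q := by
      rw [← hq, ← huk]
      have : q k = u k := by simp [hq, update_of_ne (Ne.symm hik)]
      rw [← this, update_eq_self]
    have e3 : update (update u i (y i)) k (x k) = p' := by rw [← hq]
    have e4 : update (update u i (x i)) k (y k) = u := by
      rw [← hui, update_eq_self, ← huk, update_eq_self]
    rw [e1, e2, e3, e4] at h
    exact h
  -- combine
  have hv0 := hw0 v
  have key : (w x * w y) * w p' < (w v * w u) * w p' := by
    calc (w x * w y) * w p' = (w x * w p') * w y := by ring
      _ ≤ (w p * w m) * w y := mul_le_mul_of_nonneg_right S2 (hw0 y).le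
      _ = w m * (w p * w y) := by ring
      _ ≤ w m * (w v * w q) := mul_le_mul_of_nonneg_left S1 (hw0 m).le
      _ = w v * (w m * w q) := by ring
      _ < w v * (w p' * w u) := mul_lt_mul_of_pos_left S3 hv0
      _ = (w v * w u) * w p' := by ring
  exact lt_of_mul_lt_mul_right key (hw0 p').le

end Algebra

/-! ## §2 Strict links compose through an integrated coordinate -/

section CoordAvg

variable [Fintype κ] [DecidableEq κ] (μ : Measure X) [IsProbabilityMeasure μ]

/-- **STRICT LINKS COMPOSE THROUGH AN INTEGRATED COORDINATE**: `w > 0` bounded measurable MTP₂ with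
strict pure `(a, k)`-squares AND strict pure `(k, j)`-squares, `a, j, k` distinct, and a reference
probability measure that is not a point mass (`(μ⊗μ){s < t} > 0`) ⇒ `A_k w` has strict pure
`(a, j)`-squares: integrating the middle variable of a strictly linked triple links its ends strictly
(the crossed terms of the symmetrised integrand are strict by `crossed_lt_of_pureSq_lt`). [ours] -/
theorem pureSq_coordAvg_singleton_link (k : κ) {w : (κ → X) → ℝ} (hwm : Measurable w)
    (hw0 : ∀ x, 0 < w x) {C : ℝ} (hwC : ∀ x, |w x| ≤ C)
    (hw : ∀ x y, w x * w y ≤ w (x ⊔ y) * w (x ⊓ y)) {a j : κ} (haj : a ≠ j) (hka : k ≠ a)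
    (hkj : k ≠ j)
    (hsqa : ∀ z (α α' β β' : X), α < α' → β < β' →
      w (update (update z a α) k β') * w (update (update z a α') k β) <
        w (update (update z a α') k β') * w (update (update z a α) k β))
    (hsqj : ∀ z (α α' β β' : X), α < α' → β < β' →
      w (update (update z k α) j β') * w (update (update z k α') j β) <
        w (update (update z k α') j β') * w (update (update z k α) j β))
    (hμ : 0 < (μ.prod μ) {p : X × X | p.1 < p.2})
    (z : κ → X) {α α' β β' : X} (hα : α < α') (hβ : β < β') :
    coordAvg μ {k} w (update (update z a α) j β') * coordAvg μ {k} w (update (update z a α') j β) <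
      coordAvg μ {k} w (update (update z a α') j β') *
        coordAvg μ {k} w (update (update z a α) j β) := by
  have hsup := upd2_sup_upd2 z haj hα.le hβ.le
  have hinf := upd2_inf_upd2 z haj hα.le hβ.le
  have hint : ∀ x : κ → X, Integrable (fun s => w (update x k s)) μ := fun x =>
    Integrable.mono' (integrable_const C) ((hwm.comp (measurable_update x)).aestronglyMeasurable)
      (ae_of_all _ fun s => by rw [Real.norm_eq_abs]; exact hwC _)
  have hF : ∀ (x y : κ → X) (s t : X), w (update x k s) * w (update y k t) ≤
      w (update (x ⊔ y) k (max s t)) * w (update (x ⊓ y) k (min s t)) := fun x y s t => by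
    rw [← update_sup_update, ← update_inf_update]; exact hw _ _
  -- values of the two test configurations at `a`, `j`
  have hXa : update (update z a α) j β' a = α := by simp [update_of_ne haj]
  have hXj : update (update z a α) j β' j = β' := by simp
  have hYa : update (update z a α') j β a = α' := by simp [update_of_ne haj]
  have hYj : update (update z a α') j β j = β := by simp
  have h1 : ∀ p : X × X, p.1 < p.2 →
      w (update (update (update z a α) j β') k p.1) * w (update (update (update z a α') j β) k p.2) <
        w (update (update (update z a α) j β' ⊔ update (update z a α') j β) k p.2) *
          w (update (update (update z a α) j β' ⊓ update (update z a α') j β) k p.1) := by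
    intro p hp
    have e1 : update (update (update z a α) j β') k p.1 ⊔ update (update (update z a α') j β) k p.2 =
        update (update (update z a α) j β' ⊔ update (update z a α') j β) k p.2 := by
      rw [update_sup_update, max_eq_right hp.le]
    have e2 : update (update (update z a α) j β') k p.1 ⊓ update (update (update z a α') j β) k p.2 =
        update (update (update z a α) j β' ⊓ update (update z a α') j β) k p.1 := by
      rw [update_inf_update, min_eq_left hp.le]
    rw [← e1, ← e2]
    refine crossed_lt_of_pureSq_lt hw0 hw hkj hsqj ?_ ?_
    · simpa using hp
    · rw [update_of_ne (Ne.symm hkj), update_of_ne (Ne.symm hkj), hXj, hYj]; exact hβ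
  have h2 : ∀ p : X × X, p.1 < p.2 →
      w (update (update (update z a α) j β') k p.2) * w (update (update (update z a α') j β) k p.1) <
        w (update (update (update z a α) j β' ⊔ update (update z a α') j β) k p.2) *
          w (update (update (update z a α) j β' ⊓ update (update z a α') j β) k p.1) := by
    intro p hp
    have e1 : update (update (update z a α) j β') k p.2 ⊔ update (update (update z a α') j β) k p.1 =
        update (update (update z a α) j β' ⊔ update (update z a α') j β) k p.2 := by
      rw [update_sup_update, max_eq_left hp.le]
    have e2 : update (update (update z a α) j β') k p.2 ⊓ update (update (update z a α') j β) k p.1 =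
        update (update (update z a α) j β' ⊓ update (update z a α') j β) k p.1 := by
      rw [update_inf_update, min_eq_right hp.le]
    rw [← e1, ← e2]
    refine crossed_lt_of_pureSq_lt hw0 hw (Ne.symm hka) hsqa ?_ ?_
    · rw [update_of_ne (Ne.symm hka), update_of_ne (Ne.symm hka), hXa, hYa]; exact hα
    · simpa using hp
  have key := mtp2_integral_lt μ (fun x s => w (update x k s)) (fun x s => (hw0 _).le) hF hint
    (update (update z a α) j β') (update (update z a α') j β) hμ
    (fun p hp => mtp2_integrand_lt_of_offdiag (fun x s => w (update x k s)) (fun x s => (hw0 _).le)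
      hF _ _ (le_of_lt hp) (h1 p hp) (h2 p hp))
  rw [← hsup, ← hinf]
  simp only [coordAvg_singleton_of_measurable μ k hwm]
  exact key

end CoordAvg

/-! ## §3 Strict linking propagates along integrated chains -/

section Chain

variable [Fintype κ] [DecidableEq κ] (μ : Measure X) [IsProbabilityMeasure μ]

omit [MeasurableSpace X] [Fintype κ] in
/-- A strict pure square can only link two DISTINCT coordinates (if the order has two comparable
points). [ours] -/
theorem ne_of_pureSq {w : (κ → X) → ℝ} {i k : κ} (hex : ∃ α α' : X, α < α')
    (hsq : ∀ z (α α' β β' : X), α < α' → β < β' →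
      w (update (update z i α) k β') * w (update (update z i α') k β) <
        w (update (update z i α') k β') * w (update (update z i α) k β)) : i ≠ k := by
  rintro rfl
  obtain ⟨α, α', hα⟩ := hex
  classical
  have h := hsq (fun _ => α) α α' α α' hα hα
  simp only [update_idem] at h
  exact lt_irrefl _ h

/-- **STRICT SQUARES SURVIVE INTEGRATING ANY BLOCK AVOIDING THE PAIR**: `w ≥ 0` bounded measurable
MTP₂ with strict pure `(a, j)`-squares and `a, j ∉ s` ⇒ `A_s w` has strict pure `(a, j)`-squares.
[ours] -/
theorem pureSq_coordAvg (s : Finset κ) :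
    ∀ {w : (κ → X) → ℝ}, Measurable w → (∀ x, 0 ≤ w x) → (∃ C, ∀ x, |w x| ≤ C) →
      (∀ x y, w x * w y ≤ w (x ⊔ y) * w (x ⊓ y)) →
      ∀ {a j : κ}, a ≠ j → a ∉ s → j ∉ s →
      (∀ z (α α' β β' : X), α < α' → β < β' →
        w (update (update z a α) j β') * w (update (update z a α') j β) <
          w (update (update z a α') j β') * w (update (update z a α) j β)) →
      ∀ z (α α' β β' : X), α < α' → β < β' →
        coordAvg μ s w (update (update z a α) j β') * coordAvg μ s w (update (update z a α') j β) <
          coordAvg μ s w (update (update z a α') j β') *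
            coordAvg μ s w (update (update z a α) j β) := by
  induction s using Finset.induction_on with
  | empty =>
    intro w _ _ _ _ a j _ _ _ hsq z α α' β β' hα hβ
    simpa [coordAvg_empty] using hsq z α α' β β' hα hβ
  | insert k s hk ih =>
    intro w hwm hw0 hwC hw a j haj ha hj hsq z α α' β β' hα hβ
    obtain ⟨C, hC⟩ := hwC
    simp only [coordAvg_insert_of_bounded μ hk hwm hC]
    obtain ⟨hm1, h01, hC1⟩ := coordAvg_singleton_props μ k hwm hw0 hC
    have hka : k ≠ a := fun h => ha (h ▸ Finset.mem_insert_self k s)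
    have hkj : k ≠ j := fun h => hj (h ▸ Finset.mem_insert_self k s)
    exact ih hm1 h01 ⟨C, hC1⟩ (mtp2_coordAvg_singleton μ k hwm hw0 hC hw) haj
      (fun h => ha (Finset.mem_insert_of_mem h)) (fun h => hj (Finset.mem_insert_of_mem h))
      (fun z α α' β β' hα hβ => pureSq_coordAvg_singleton μ k hwm hw0 hC hw haj hka hkj hsq z hα hβ)
      z α α' β β' hα hβ

/-- **STRICT LINKING PROPAGATES ALONG AN INTEGRATED CHAIN** (the `d ≥ 2` engine of C5): `w > 0`
bounded measurable MTP₂; a chain `a = c₀, c₁, …, cₙ, cₙ₊₁ = j` whose interior `[c₁, …, cₙ]` is a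
duplicate-free list of INTEGRATED coordinates (`⊆ s`, while `a, j ∉ s`) with every consecutive pair
strictly linked (strict pure squares); reference probability measure not a point mass.  Then the
partial average `A_s w` is STRICTLY TP₂ in the pair `(a, j)` with everything else frozen:
`A_s w(z[a↦α][j↦β'])·A_s w(z[a↦α'][j↦β]) < A_s w(z[a↦α'][j↦β'])·A_s w(z[a↦α][j↦β])` for all `z`,
`α < α'`, `β < β'` (integrate `c₁` first: it links `a` to `c₂` strictly, the other links survive;
induct). [ours] -/
theorem pureSq_coordAvg_of_chain (hμ : 0 < (μ.prod μ) {p : X × X | p.1 < p.2}) :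
    ∀ (P : List κ) (s : Finset κ) {w : (κ → X) → ℝ}, Measurable w → (∀ x, 0 < w x) →
      (∃ C, ∀ x, |w x| ≤ C) → (∀ x y, w x * w y ≤ w (x ⊔ y) * w (x ⊓ y)) →
      ∀ {a j : κ}, a ≠ j → a ∉ s → j ∉ s → (∀ c ∈ P, c ∈ s) → P.Nodup →
      List.IsChain (fun i k => ∀ z (α α' β β' : X), α < α' → β < β' →
          w (update (update z i α) k β') * w (update (update z i α') k β) <
            w (update (update z i α') k β') * w (update (update z i α) k β)) (a :: (P ++ [j])) →
      ∀ z (α α' β β' : X), α < α' → β < β' →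
        coordAvg μ s w (update (update z a α) j β') * coordAvg μ s w (update (update z a α') j β) <
          coordAvg μ s w (update (update z a α') j β') *
            coordAvg μ s w (update (update z a α) j β) := by
  have hex : ∃ α α' : X, α < α' := by
    obtain ⟨p, hp⟩ := nonempty_of_measure_ne_zero (ne_of_gt hμ)
    exact ⟨p.1, p.2, hp⟩
  intro P
  induction P with
  | nil =>
    intro s w hwm hw0 hwC hw a j haj ha hj _ _ hchain
    have hsq : ∀ z (α α' β β' : X), α < α' → β < β' →
        w (update (update z a α) j β') * w (update (update z a α') j β) <
          w (update (update z a α') j β') * w (update (update z a α) j β) := by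
      simpa using hchain
    exact pureSq_coordAvg μ s hwm (fun x => (hw0 x).le) hwC hw haj ha hj hsq
  | cons c P ih =>
    intro s w hwm hw0 hwC hw a j haj ha hj hP hnd hchain z α α' β β' hα hβ
    obtain ⟨C, hC⟩ := hwC
    have hcs : c ∈ s := hP c (by simp)
    have hca : c ≠ a := fun h => ha (h ▸ hcs)
    have hcj : c ≠ j := fun h => hj (h ▸ hcs)
    have hcP : c ∉ P := (List.nodup_cons.1 hnd).1
    have hndP : P.Nodup := (List.nodup_cons.1 hnd).2
    -- integrate `c` first
    have hs : s = insert c (s.erase c) := (Finset.insert_erase hcs).symm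
    rw [hs]
    simp only [coordAvg_insert_of_bounded μ (Finset.notMem_erase c s) hwm hC]
    obtain ⟨hm1, h01, hC1⟩ := coordAvg_singleton_props μ c hwm (fun x => (hw0 x).le) hC
    have hpos1 : ∀ x, 0 < coordAvg μ {c} w x :=
      fun x => coordAvg_singleton_pos μ c hwm hw0 hC x
    have hmtp1 := mtp2_coordAvg_singleton μ c hwm (fun x => (hw0 x).le) hC hw
    -- the head link `a — c` and the rest of the chain
    obtain ⟨hac, hrest⟩ := List.isChain_cons_cons.1 hchain
    refine ih (s.erase c) hm1 hpos1 ⟨C, hC1⟩ hmtp1 haj (fun h => ha (Finset.mem_of_mem_erase h))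
      (fun h => hj (Finset.mem_of_mem_erase h))
      (fun c' hc' => Finset.mem_erase.2 ⟨fun h => hcP (h ▸ hc'), hP c' (by simp [hc'])⟩) hndP ?_
      z α α' β β' hα hβ
    -- the chain for the new weight `A_c w`
    cases P with
    | nil =>
      have hcj' : ∀ z (α α' β β' : X), α < α' → β < β' →
          w (update (update z c α) j β') * w (update (update z c α') j β) <
            w (update (update z c α') j β') * w (update (update z c α) j β) := by
        simpa using hrest
      simp only [List.nil_append, List.isChain_pair]
      intro z α α' β β' hα hβ
      exact pureSq_coordAvg_singleton_link μ c hwm hw0 hC hw haj hca hcj hac hcj' hμ z hα hβ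
    | cons d P' =>
      obtain ⟨hcd, htail⟩ := List.isChain_cons_cons.1 hrest
      change List.IsChain _ (d :: (P' ++ [j])) at htail
      have hda : a ≠ d := fun h => ha (h ▸ hP d (by simp))
      have hcd' : c ≠ d := fun h => hcP (by simp [h])
      refine List.isChain_cons_cons.2 ⟨fun z α α' β β' hα hβ => ?_, ?_⟩
      · exact pureSq_coordAvg_singleton_link μ c hwm hw0 hC hw hda hca hcd' hac hcd hμ z hα hβ
      · change List.IsChain _ (d :: (P' ++ [j]))
        refine htail.imp_of_mem_imp fun i k hi hk hik => ?_
        have hci : c ≠ i := by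
          intro h; subst h
          simp only [List.mem_cons, List.mem_append, List.not_mem_nil, or_false] at hi
          rcases hi with h | h | h
          · exact hcd' h
          · exact hcP (by simp [h])
          · exact hcj h
        have hck : c ≠ k := by
          intro h; subst h
          simp only [List.mem_cons, List.mem_append, List.not_mem_nil, or_false] at hk
          rcases hk with h | h | h
          · exact hcd' h
          · exact hcP (by simp [h])
          · exact hcj h
        intro z α α' β β' hα hβ
        exact pureSq_coordAvg_singleton μ c hwm (fun x => (hw0 x).le) hC hw (ne_of_pureSq hex hik)
          hci hck hik z hα hβ

end Chain

end Summit.Ventures.LatticeQCDFlow.Theory2.Autoregressive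

end
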